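import Literature.NumberTheory.Sieve.ParityBatemanHorn
import Literature.NumberTheory.Sieve.BatemanHornProofs
import Literature.NumberTheory.Sieve.PolynomialValuesSieveSequence
import Literature.NumberTheory.Sieve.SieveFunctions
import Literature.NumberTheory.Sieve.BatemanHornIwaniecDimension
import Literature.NumberTheory.Sieve.BatemanHornAlmostPrimes
import Literature.NumberTheory.Sieve.BatemanHornSelbergUpperBound
import Mathlib.NumberTheory.AlmostPrime
import HarnessLib

/-!
# Bateman–Horn at the parity boundary: the sieve bounds that hold for EVERY system

Trunk T-SIEVE (`Literature/NumberTheory/Sieve`).  The conjunct `Summit.Parity.BatemanHorn` of the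
summit asks, for every Bateman–Horn system `f = (f₁, …, f_k)` of integer polynomials
(`IsBatemanHornSystem f`: distinct irreducible, positive leading coefficients, no fixed prime
divisor of `∏ fᵢ`), the asymptotic `P_f(x) ~ C(f)/(∏ deg fᵢ) · x/(log x)^k` for the prime-value
count `P_f(x) = polyPrimeCount f x` with the singular series `C(f) = batemanHornConst f =
∏_p (1 − 1/p)^{−k}(1 − ω_f(p)/p)`.  Classical sieve theory proves, UNIFORMLY over all systems and
over the same objects, exactly two things, and this file states them as named facts:

* `UpperBound` — **Selberg's upper bound at the parity constant**: `P_f(x) ≤ (2^k k! + ε) C(f)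
  x/(log x)^k` for all large `x` — Diamond–Halberstam–Galway, *A Higher-Dimensional Sieve Method*,
  Cor. 5.7 (Selberg's sieve under `Ω(κ)`, `κ = k`, `z = x^{1/2}`) and Example 5.8, (5.47) (with
  `y = x`); Halberstam–Richert, *Sieve Methods*, Thm. 5.3.  The bound exceeds the conjectured
  asymptotic by the factor `2^k · k! · ∏ deg fᵢ` (for one linear polynomial: the Brun–Titchmarsh
  constant `2`); the factor is the parity (and dimension) loss of the sieve.
* `AlmostPrimes` — **almost-prime values**: for `r = r(k, deg)` and `c = c(k, deg) > 0`,
  `#{n ≤ x : Ω(∏ fᵢ(n)) ≤ r} ≥ c · C(f) · x/(log x)^k` for all large `x` — Halberstam–Richert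
  Thm. 10.4; Diamond–Halberstam–Galway §11.5, (11.24) (any `r` exceeding the right side of (11.24)
  is admissible; a cruder `r` already follows from the Fundamental Lemma, tree
  `SieveSequence.fundamental_lemma_uniform_holds`, after a pre-sieve of the small primes).
* `Dimension` — every Bateman–Horn system is a sieve problem of dimension `k` in Iwaniec's sense
  `Ω(k, L)` (Diamond–Halberstam–Galway (1.5); the tree's `HasIwaniecDimension`), a consequence of
  Mertens' theorems for the root counts with rate (PROVED in the tree:
  `IsBatemanHornSystem.exists_hasIwaniecDimension`, `BatemanHornIwaniecDimension.lean`; here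
  `Dimension_holds`).
* `Rung := UpperBound ∧ AlmostPrimes` — «Bateman–Horn at the parity boundary» (ladder label F-BHΩ).
  Also recorded: the printed linear-case value `ThreeLinearFormsP9` (Diamond–Halberstam–Galway Example 11.3:
  three admissible linear forms take a `P₉` product; two forms: `P₅`, the tree's
  `DiamondHalberstam1997_twoLinear_P5_holds`).

HONESTY LABEL. Formalisation-first of printed theorems; the statements sit INSIDE the parity
barrier (`Literature.Barriers.Parity.SelbergParity`) by design and claim no prime value of any
polynomial of degree ≥ 2.  Proved here: `Dimension_holds` (from the tree's
`IsBatemanHornSystem.exists_hasIwaniecDimension`, `BatemanHornIwaniecDimension.lean`) and the trivial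
(nothing else); `UpperBound` and `AlmostPrimes` are hypotheses `(h : UpperBound)` etc. until
their `_holds` theorems land (the case `k = 1` of `UpperBound` is the tree's
`polyPrimeCount_single_le_linearSieve`, `PolynomialPrimesLinearSieveBound.lean`).

## References
* H. G. Diamond, H. Halberstam, W. F. Galway, *A Higher-Dimensional Sieve Method*, Cambridge
  Tracts 177, CUP (2008): §1.4 (1.5); Thm. 5.6, Cor. 5.7, Example 5.8 (5.47); §11.5 (11.24)–(11.26),
  Example 11.3. [DiamondHalberstamGalway2008]
* G. Greaves, *Sieves in Number Theory*, Springer (2001): §2.2 Thm. 2 (the lower bound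
  `G(z) ≥ e^{−γκ}/(Γ(κ+1) V(P(z))) (1 + O(A/log z))`), §2.3 Thm. 4 (`π(f, X) ≤ 2^k k! C X/log^k X`,
  `f` with `k` irreducible factors — `UpperBound` verbatim). [Greaves2001]
* H. Halberstam, H.-E. Richert, *Sieve Methods*, Academic Press (1974): Thm. 5.3, Thm. 10.4.
  [HalberstamRichert1974]
* P. T. Bateman, R. A. Horn, Math. Comp. 16 (1962) 363–367 (the conjecture; tree
  `Literature.NumberTheory.Sieve.BatemanHornConjecture`). [BatemanHorn1962]
-/

open Filter Finset Polynomial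

namespace Literature.NumberTheory.Sieve

namespace BatemanHornParityBoundary

/-! ### The almost-prime counting function of a system -/

open scoped Classical in
/-- `P_f^{(r)}(x) = #{n ≤ x : ∏ᵢ fᵢ(n) ≠ 0 ∧ Ω(|∏ᵢ fᵢ(n)|) ≤ r}`, the number of `n ≤ x` at which the
product of the system is a non-zero `P_r` (`Nat.IsAtMostAlmostPrime r m`: `Ω(m) ≤ r`, Mathlib).
[folklore] -/
noncomputable def polyAlmostPrimeCount {ι : Type*} [Fintype ι] (f : ι → ℤ[X]) (r x : ℕ) : ℕ :=
  #((range (x + 1)).filter fun n : ℕ ↦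
    (∏ i, (f i).eval (n : ℤ)) ≠ 0 ∧ Nat.IsAtMostAlmostPrime r (∏ i, (f i).eval (n : ℤ)).natAbs)

/-! ### The three named facts -/

/-- **Selberg's upper bound for a Bateman–Horn system, at the parity constant.** For every
Bateman–Horn system `f` of `k` polynomials and every `ε > 0`,
`P_f(x) ≤ (2^k · k! + ε) · C(f) · x/(log x)^k` for all sufficiently large `x`
(Greaves §2.3 Thm. 4 verbatim; = DHG Cor. 5.7 with `κ = k`, `z = x^{1/2}`, `X = x`,
`|r_d| ≤ ω_f(d)`, Example 5.8 (5.47) with `y = x`). The case `k = 1` is PROVED in the tree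
(`polyPrimeCount_single_le_linearSieve`). [cite: Greaves2001, §2.3 Theorem 4]
[cite: DiamondHalberstamGalway2008, Cor. 5.7 and Example 5.8 (5.47)] -/
def UpperBound : Prop :=
  ∀ (k : ℕ) (f : Fin k → ℤ[X]), IsBatemanHornSystem f → ∀ ε : ℝ, 0 < ε →
    ∀ᶠ x : ℕ in atTop,
      (polyPrimeCount f x : ℝ) ≤
        (2 ^ k * (k.factorial : ℝ) + ε) * batemanHornConst f * (x : ℝ) / Real.log x ^ k

/-- **Almost-prime values of a Bateman–Horn system.** For every `k` and every degree vector `d`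
there are `r = r(k, d)` and `c = c(k, d) > 0` such that for every Bateman–Horn system `f` of `k`
polynomials with `deg fᵢ = dᵢ`, `#{n ≤ x : Ω(∏ fᵢ(n)) ≤ r} ≥ c · C(f) · x/(log x)^k` for all
sufficiently large `x` (Halberstam–Richert Thm. 10.4; any `r` exceeding the right-hand side of
(11.24) is admissible). [cite: DiamondHalberstamGalway2008, §11.5 (11.24)] -/
def AlmostPrimes : Prop :=
  ∀ (k : ℕ) (d : Fin k → ℕ), ∃ r : ℕ, ∃ c : ℝ, 0 < c ∧
    ∀ f : Fin k → ℤ[X], IsBatemanHornSystem f → (∀ i, (f i).natDegree = d i) →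
      ∀ᶠ x : ℕ in atTop,
        c * batemanHornConst f * (x : ℝ) / Real.log x ^ k ≤ (polyAlmostPrimeCount f r x : ℝ)

/-- **Every Bateman–Horn system is a sieve problem of dimension `k`** in Iwaniec's regular sense
`Ω(k, L)` — (1.5) of the source, the tree's `HasIwaniecDimension` — for the root density
`p ↦ ω_H(p)/p` of the product `H = ∏ fᵢ` (tree `rootDensity`; `ω_H = ω_f` by
`polyRootCountMod f p = polyRootCountMod ![∏ i, f i] p`): there is `L = L(f)` with
`∏_{w ≤ p < z} (1 − ω_f(p)/p)⁻¹ ≤ (log z/log w)^k (1 + L/log w)` for all `2 ≤ w ≤ z` (Mertens' theorem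
for `ω_f`, cf. the proof of Example 5.8).
[cite: DiamondHalberstamGalway2008, §1.4 (1.5) and §5.4 (proof of Example 5.8)] -/
def Dimension : Prop :=
  ∀ (k : ℕ) (f : Fin k → ℤ[X]), IsBatemanHornSystem f →
    ∃ L : ℝ, HasIwaniecDimension (rootDensity (∏ i, f i)) k L

/-! ### Variants recorded for the ladder -/

/-- The printed value in the linear case `k = 3`: the product of three admissible linear forms is
a `P₉` for `≫ C(f) · x/(log x)^3` integers `n ≤ x` ((11.26) with `ξ = 10`, `f₃(10) = 0.9804…`;
for `k = 2` the value is `P₅`, the tree's `DiamondHalberstam1997_twoLinear_P5_holds`).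
[cite: DiamondHalberstamGalway2008, Example 11.3] -/
def ThreeLinearFormsP9 : Prop :=
  ∃ c : ℝ, 0 < c ∧ ∀ f : Fin 3 → ℤ[X], IsBatemanHornSystem f → (∀ i, (f i).natDegree = 1) →
    ∀ᶠ x : ℕ in atTop,
      c * batemanHornConst f * (x : ℝ) / Real.log x ^ 3 ≤ (polyAlmostPrimeCount f 9 x : ℝ)

/-! ### The rung -/

/-- THE RUNG (ladder label F-BHΩ): Bateman–Horn at the parity boundary for every system = the
conjunction of the two printed theorems `UpperBound` (Greaves §2.3 Thm. 4 / DHG Cor. 5.7) and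
`AlmostPrimes` (Halberstam–Richert Thm. 10.4 / DHG §11.5 (11.24)).
[cite: Greaves2001, §2.3 Theorem 4] [cite: HalberstamRichert1974, Thm 10.4] -/
def Rung : Prop := UpperBound ∧ AlmostPrimes

/-- `Dimension` is a THEOREM of the tree (`BatemanHornIwaniecDimension.lean`: Mertens' theorems for
the root counts with rate, from the prime ideal theorem) — our proof of the cited statement
(DHG §5.4: the polynomial sequence satisfies `Ω(κ)` with `κ = k`).
[cite: DiamondHalberstamGalway2008, §1.4 (1.5) and §5.4 (Example 5.8)] -/
theorem Dimension_holds : Dimension := fun _k _f hf ↦ hf.exists_hasIwaniecDimension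

/-- `AlmostPrimes` is a THEOREM of the tree (`BatemanHornAlmostPrimes.lean`: the uniform Fundamental
Lemma on the values `∏ fᵢ(m)`, Mertens along the system, and `Ω ≤ r` for rough values; `r = r(k,d)`,
`c = e^{-kγ}/16`) — our proof of the qualitative form of the cited statement.
[cite: DiamondHalberstamGalway2008, §11.5 (11.24)] -/
theorem AlmostPrimes_holds : AlmostPrimes := by
  intro k d
  obtain ⟨r, c, hc, h⟩ := BatemanHornAlmostPrimes.batemanHorn_almostPrimes k d
  refine ⟨r, c, hc, fun f hf hdeg => ?_⟩
  filter_upwards [h f hf hdeg] with x hx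
  unfold polyAlmostPrimeCount
  convert hx using 4

/-- `UpperBound` is a THEOREM of the tree (`BatemanHornSelbergUpperBound.lean`: Selberg's `Λ²` sieve
on the values of `∏ fᵢ`, the van Lint–Richert minorant of `G(√D)` and its mean value by Karamata's
Tauberian theorem) — our proof of the cited statement, for every `k`.
[cite: Greaves2001, §2.3 Theorem 4] -/
theorem UpperBound_holds : UpperBound := fun _k _f hf _ε hε =>
  BatemanHornSelberg.polyPrimeCount_le_selbergSieve hf hε

/-- THE RUNG F-BHΩ — Bateman–Horn at the parity boundary for every system — is a theorem of the
tree: both printed halves are proved (`UpperBound_holds`, `AlmostPrimes_holds`).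
[cite: Greaves2001, §2.3 Theorem 4] [cite: HalberstamRichert1974, Thm 10.4] -/
theorem Rung_holds : Rung := ⟨UpperBound_holds, AlmostPrimes_holds⟩

end BatemanHornParityBoundary

end Literature.NumberTheory.Sieve
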